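import Literature.Combinatorics.StablePolynomials.MultiAffinePart
import Literature.Combinatorics.StablePolynomials.BlockGraceWalshSzego
import Literature.Combinatorics.StablePolynomials.Limits
import Mathlib.Data.Nat.Choose.Multinomial
import Mathlib.Data.Fintype.Fin
import HarnessLib

/-!
# Stability of the multivariate `d`-matching polynomial of a multigraph (Amini 2019, Thm. 3.7 ∕ Cor. 3.8;
# Hall–Puder–Sawin's `d`-matching polynomial (2.4)), weak Hurwitz form with vertex capacities

N. Amini, *Stable multivariate generalizations of matching polynomials*, arXiv:1905.02264 (2019), §3:

> Define the multivariate `d`-matching polynomial of `G` by `μ_{d,G}(x) ≔ 𝔼_{H ∈ 𝒞_{d,G}} μ_H(x)` …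
> **Theorem 3.7.** If `G` is a finite multigraph (possibly with loops), then `μ_{d,G}(x)` is stable for all
> `d ≥ 1`.  *Proof.* For a `d`-covering `σ : E(G) → S_d`, let
> `P_{σ,G}(x) ≔ ∏_{e} ∏_{k=1}^d (1 - x_{h(e)k} x_{t(e)σ_e(k)})` … `MAP[P_{σ,G}(x)] = μ_H(x)`. We have
> `𝔼_σ P_{σ,G}(x) = |𝒞_{d,G}|⁻¹ ∏_{e} Σ_{σ_e ∈ S_d} ∏_{k=1}^d (1 - x_{h(e)k} x_{t(e)σ_e(k)})`.  For `e` the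
> polynomials `f_e(x) = Σ_{σ_e ∈ S_d} ∏_k (1 - x_{h(e)k} x_{t(e)σ_e(k)})` are symmetric and multiaffine
> polynomials in the two sets of variables `{x_{h(e)k}}`, `{x_{t(e)k}}`.  By [Grace–Walsh–Szegő] `f_e(x)` is
> stable if and only if `Σ_{σ_e} ∏_k (1 - xy) = d!(1-xy)^d` is stable, the latter of which is clear. … Hence
> `𝔼_σ P_{σ,G}(x)` is stable being a product of stable polynomials. Finally
> `MAP[𝔼_σ P_{σ,G}(x)] = 𝔼_σ MAP[P_{σ,G}(x)] = 𝔼_H μ_H(x) = μ_{d,G}(x)`. Hence `μ_{d,G}(x)` is stable. □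
> **Corollary 3.8.** … `μ_{d,G}(x)` is real-rooted for all `d ≥ 1`. *Proof.* Put `x = (x,…,x)`.

and C. Hall, D. Puder, W. F. Sawin, *Ramanujan coverings of graphs*, Adv. Math. 323 (2018) 367–410, §2.2
(2.4): the `d`-matching polynomial is the multi-matching sum `Σ_n W_d(n) …` over `n : E → {0,…,d}` with
`W_d(n) = ∏_v multinomial(d; (n_e)_{e ∋ v}) / ∏_e binom(d, n_e)` (the expected number of matchings of a
random `d`-covering projecting to `n`).

THIS FILE proves Amini's theorem in the WEAK HURWITZ (right half-plane `H_{π/2}`) form, for loopless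
multigraphs, with VERTEX CAPACITIES, following the printed proof step by step with the tree's
Borcea–Brändén library:
* the multigraph is a finite vertex type `V`, a finite bond type `β` with end points `s t : β → V`
  (`s b ≠ t b`); the `N|V|` covering variables `x_{v,k}` are indexed by `V × Fin N`, the blocks being the
  fibres of `Prod.fst` (the tree's `fiber`, `fiberEsymm` of `BlockPolarization`);
* Amini's `f_e`, summed over `σ_e ∈ S_d` in closed form, is `coverBond` :
  `f_b = Σ_{j ≤ N} j!(N-j)! N^{2j} e_j(x_{s b,·}) e_j(x_{t b,·})` (sign `+`, edge weight `N²`: the weak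
  Hurwitz version, `∏_k (1 + N² x x')`); its value at a block-constant point is `N!(1 + N² ζ_{s b}ζ_{t b})^N`
  (`eval_comp_fst_coverBond`), and the block Grace–Walsh–Szegő theorem for the right half-plane (tree:
  `exists_eval_eq_eval_comp_of_hasCoincidenceProperty`, `hasCoincidenceProperty_im_affine_pos`) gives its
  weak Hurwitz stability (`coverBond_weaklyHurwitzStable`); the product `coverPoly = ∏_b f_b` is weakly
  Hurwitz stable (`coverPoly_weaklyHurwitzStable`);
* `MAP` preserves weak Hurwitz stability (tree: `multiAffinePart_weaklyHurwitzStable`, Borcea–Brändén II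
  §8.4), and `MAP(F) ≠ 0` because `MAP(F)(0) = F(0) = (N!)^{|β|}`
  (`multiAffinePart_coverPoly_weaklyHurwitzStable`);
* the diagonalisation `x_{v,k} := τ_v` of Cor. 3.8 is generalised to the FACE POINTS `φ_{c,τ}`
  (`facePoint`: `τ_v` on the first `c_v ≤ N` covering variables above `v`, `0` on the others); a weakly
  Hurwitz stable polynomial with non-zero constant term does not vanish on such faces
  (`IsHThetaStable.eval_ne_zero_of_face`, by Hurwitz's theorem through the tree's
  `eq_zero_or_isUpperHalfPlaneStable_of_mem_closure` — Wagner's Lemma 2.4 (d)), so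
  `MAP(F)(φ_{c,τ}) ≠ 0` for `Re τ_v > 0` (`eval_facePoint_multiAffinePart_coverPoly_ne_zero`);
* the face value is computed in closed form (`eval_facePoint_multiAffinePart_coverPoly`): with the
  `MAP`-algebra of §2 (`MAP(Q·MAP P) = MAP(Q·P)`, multiplicativity of `MAP` across disjoint blocks of
  variables, `MAP(e_a e_b) = binom(a+b,a) e_{a+b}` and `MAP(∏_ℓ e_{m_ℓ}) = multinomial(m) e_{Σ m}` inside one
  block — Hall–Puder–Sawin's count (2.4)), `MAP(F)(φ_{c,τ}) = Σ_n ∏_b w_N(n_b) ∏_v multinomial((n_e)_{e∋v})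
  binom(c_v, d_v(n)) τ_v^{d_v(n)}`, the multi-matching sum with capacities; hence
  **`multiMatchingSum_ne_zero`**: this sum is `≠ 0` whenever all `Re τ_v > 0`.
For `c_v = N` and `τ_v = x_v` this is (up to the normalisation `(N!)^{|β|}` and the edge weight `N²`) the
weak Hurwitz stability of Hall–Puder–Sawin's multivariate `N`-matching polynomial, i.e. Amini's
Theorem 3.7 ∕ Cor. 3.8 after the rotation `x ↦ -ix`.  The capacities serve the `β = 0` `U(N)` lattice
gauge theory (`Literature/MathematicalPhysics/StatisticalMechanics/UNPartitionFunctionZeros`), whose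
capacity partition functions are exactly these sums.

-- TODO(general form): loops (Amini's factors `∏_{k : σ_e(k) ≠ k}`) and the upper-half-plane statement
-- of Thm. 3.7 itself (equivalent by the rotation `x ↦ -ix`; not needed downstream).

## Contents

* §1 `IsHThetaStable.eval_ne_zero_of_face` (faces of the boundary of `H_{π/2}^n`).
* §2 `MAP` algebra: `multiAffinePart_mul_multiAffinePart`, `multiAffinePart_mul_of_disjoint_vars`,
  `multiAffinePart_prod_of_vars_subset`, `multiAffinePart_prod_X_mul_prod_X`, `setEsymm`,
  `multiAffinePart_setEsymm_mul_setEsymm`, `multiAffinePart_prod_setEsymm`, `eval_setEsymm_of_subset`.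
* §3 `coverWeight`, `coverBond`, `coverPoly`, `eval_comp_fst_coverBond`, `isMultiAffine_coverBond`,
  `isFiberSymmetric_coverBond`, `coverBond_weaklyHurwitzStable`, `coverPoly_weaklyHurwitzStable`,
  `multiAffinePart_coverPoly_weaklyHurwitzStable`.
* §4 `facePoint`, `bondEnds`, `bondDegree`, `prod_bondEnds_eq_prod_fiber`, `eval_facePoint_multiAffinePart_coverPoly`,
  **`multiMatchingSum_ne_zero`**.

Honest framing: finite combinatorics and the zero locus of polynomials attached to finite multigraphs;
nothing here concerns Ramanujan coverings, `β > 0` lattice gauge theory or any summit statement.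

## References

* [Amini2019] N. Amini, *Stable multivariate generalizations of matching polynomials*, arXiv:1905.02264,
  §2.2 (stability, `MAP`, Grace–Walsh–Szegő), §3 Thm. 3.7 and its proof, Cor. 3.8.
* [HallPuderSawin2018] C. Hall, D. Puder, W. F. Sawin, *Ramanujan coverings of graphs*, Adv. Math. 323
  (2018) 367–410, §2.2 formula (2.4) (multi-matching weights `W_d`).
* [BorceaBranden2009II] J. Borcea, P. Brändén, Comm. Pure Appl. Math. 62 (2009) 1595–1631, §8.4 (`MAP`
  preserves weak Hurwitz stability), §2 Thm. 2.1 (Grace–Walsh–Szegő in blocks).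
* [Wagner2011] D. G. Wagner, *Multivariate stable polynomials: theory and applications*, Bull. AMS 48
  (2011) 53–84, Lemma 2.4 (d) (specialisation at boundary points).
-/

noncomputable section

open MvPolynomial Finset

namespace Literature.Combinatorics.StablePolynomials

/-! ## §1 Weakly Hurwitz stable polynomials on the faces `{z_i = 0, i ∈ T}` of the boundary -/

section Face

variable {σ : Type*}

/-- **Boundary faces.** A weakly Hurwitz stable (`H_{π/2}`-stable) polynomial `G` with `G(0) ≠ 0` does
not vanish at any point `z` with `z_i = 0` for `i ∈ T` and `Re z_i > 0` for `i ∉ T`: the specialisation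
`z_i := 0` (`i ∈ T`) of `G` is the limit `ε → 0⁺` of the specialisations `z_i := ε` and is not identically
zero (its value at `0` is `G(0)`), so it is weakly Hurwitz stable by Hurwitz's theorem (Wagner,
Lemma 2.4 (d): "Specialization: for `a ∈ H̄`, `f ↦ f(a, x_2, …, x_m)`" preserves stability, the value `0`
excluded separately; here through the tree's `eq_zero_or_isUpperHalfPlaneStable_of_mem_closure` after the
rotation `z ↦ -i z`). [cite: Wagner2011, Lemma 2.4 (d)] -/
theorem IsHThetaStable.eval_ne_zero_of_face [Fintype σ] [DecidableEq σ] {G : MvPolynomial σ ℂ}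
    (hG : IsHThetaStable (Real.pi / 2) G) (h0 : eval (0 : σ → ℂ) G ≠ 0) (T : Finset σ)
    (z : σ → ℂ) (hzT : ∀ i ∈ T, z i = 0) (hz : ∀ i, i ∉ T → 0 < (z i).re) : eval z G ≠ 0 := by
  set u : ℂ := (thetaUnit (Real.pi / 2))⁻¹ with hu
  have huI : u = -Complex.I := by rw [hu, thetaUnit_pi_div_two, Complex.inv_I]
  set G' : MvPolynomial σ ℂ := rotateVars u G with hG'def
  have hG' : IsUpperHalfPlaneStable G' := (isHThetaStable_iff_rotateVars _ _).1 hG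
  -- the points with the `T`-coordinates replaced by `iε`
  let pt : ℝ → (σ → ℂ) → σ → ℂ := fun ε w i => if i ∈ T then (ε : ℂ) * Complex.I else w i
  let P : ℝ → MvPolynomial σ ℂ := fun ε =>
    bind₁ (fun i => if i ∈ T then C ((ε : ℂ) * Complex.I) else X i) G'
  have hPeval : ∀ ε w, eval w (P ε) = eval (pt ε w) G' := by
    intro ε w
    simp only [P, eval_bind₁]
    have hfun : (fun j => eval w (if j ∈ T then C ((ε : ℂ) * Complex.I) else X j)) = pt ε w := by
      funext i
      by_cases hi : i ∈ T
      · simp [pt, hi]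
      · simp [pt, hi]
    rw [hfun]
  have hP : Continuous fun az : ℝ × (σ → ℂ) => eval az.2 (P az.1) := by
    have h1 : (fun az : ℝ × (σ → ℂ) => eval az.2 (P az.1)) =
        fun az => eval (pt az.1 az.2) G' := by
      funext az; exact hPeval az.1 az.2
    rw [h1]
    refine (MvPolynomial.continuous_eval G').comp (continuous_pi fun i => ?_)
    by_cases hi : i ∈ T
    · simp only [pt, hi, if_true]
      exact (Complex.continuous_ofReal.comp continuous_fst).mul continuous_const
    · simp only [pt, hi, if_false]
      exact (continuous_apply i).comp continuous_snd
  have hs : ∀ ε ∈ Set.Ioi (0 : ℝ), IsUpperHalfPlaneStable (P ε) := by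
    intro ε hε w hw
    rw [hPeval]
    refine hG' _ fun i => ?_
    by_cases hi : i ∈ T
    · simp only [pt, hi, if_true, Complex.mul_im, Complex.ofReal_re, Complex.I_im, Complex.ofReal_im,
        Complex.I_re, mul_one, mul_zero, add_zero]
      exact hε
    · simp only [pt, hi, if_false]
      exact hw i
  have hq : (0 : ℝ) ∈ closure (Set.Ioi (0 : ℝ)) := by
    rw [closure_Ioi]
    exact Set.self_mem_Ici
  rcases eq_zero_or_isUpperHalfPlaneStable_of_mem_closure hP hs hq with h | h
  · -- the specialisation at `0` is not the zero polynomial: its value at `0` is `G(0)`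
    exfalso
    apply h0
    have h1 := hPeval 0 0
    rw [h, map_zero] at h1
    have hpt : pt 0 0 = 0 := by
      funext i
      by_cases hi : i ∈ T
      · simp [pt, hi]
      · simp [pt, hi]
    rw [hpt, hG'def, eval_rotateVars] at h1
    have h00 : (fun i => u * (0 : σ → ℂ) i) = 0 := by funext i; simp
    rw [h00] at h1
    exact h1.symm
  · -- the specialisation at `0` is stable: evaluate it at `i z` off `T`
    let w : σ → ℂ := fun i => if i ∈ T then Complex.I else Complex.I * z i
    have hw : ∀ i, 0 < (w i).im := by
      intro i
      by_cases hi : i ∈ T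
      · simp [w, hi]
      · simp only [w, hi, if_false, Complex.I_mul_im]
        exact hz i hi
    have h1 := h w hw
    rw [hPeval, hG'def, eval_rotateVars] at h1
    have hfun : (fun i => u * pt 0 w i) = z := by
      funext i
      by_cases hi : i ∈ T
      · simp [pt, hi, hzT i hi]
      · simp only [pt, w, hi, if_false, huI]
        rw [← mul_assoc, neg_mul, Complex.I_mul_I, neg_neg, one_mul]
    rwa [hfun] at h1

end Face

/-! ## §2 Algebra of the multi-affine part `MAP` -/

section MapAlgebra

variable {σ : Type*}

/-- `MAP(Q · MAP(P)) = MAP(Q · P)`: monomials of `P` that are not square-free only produce non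
square-free monomials in `Q · P`. [cite: BorceaBranden2009II, §8.4 (definition of `MAP`)] -/
theorem multiAffinePart_mul_multiAffinePart [Fintype σ] [DecidableEq σ] (Q P : MvPolynomial σ ℂ) :
    multiAffinePart (Q * multiAffinePart P) = multiAffinePart (Q * P) := by
  ext γ
  rw [coeff_multiAffinePart, coeff_multiAffinePart]
  split_ifs with hγ
  · rw [coeff_mul, coeff_mul]
    refine sum_congr rfl fun x hx => ?_
    rw [coeff_multiAffinePart, if_pos]
    intro i
    have h := DFunLike.congr_fun (HasAntidiagonal.mem_antidiagonal.1 hx) i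
    simp only [Finsupp.add_apply] at h
    have := hγ i
    omega
  · rfl

/-- **`MAP` is multiplicative on polynomials in disjoint sets of variables.**
[cite: BorceaBranden2009II, §8.4 (definition of `MAP`)] -/
theorem multiAffinePart_mul_of_disjoint_vars [Fintype σ] [DecidableEq σ] {P Q : MvPolynomial σ ℂ}
    (h : Disjoint P.vars Q.vars) :
    multiAffinePart (P * Q) = multiAffinePart P * multiAffinePart Q := by
  ext γ
  rw [coeff_multiAffinePart, coeff_mul, coeff_mul]
  by_cases hγ : ∀ i, γ i ≤ 1
  · rw [if_pos hγ]
    refine sum_congr rfl fun x hx => ?_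
    have h12 : ∀ i, x.1 i + x.2 i = γ i := fun i => by
      have h := DFunLike.congr_fun (HasAntidiagonal.mem_antidiagonal.1 hx) i
      simpa only [Finsupp.add_apply] using h
    rw [coeff_multiAffinePart, coeff_multiAffinePart, if_pos, if_pos]
    · intro i; have := h12 i; have := hγ i; omega
    · intro i; have := h12 i; have := hγ i; omega
  · rw [if_neg hγ]
    symm
    refine sum_eq_zero fun x hx => ?_
    have h12 : ∀ i, x.1 i + x.2 i = γ i := fun i => by
      have h := DFunLike.congr_fun (HasAntidiagonal.mem_antidiagonal.1 hx) i
      simpa only [Finsupp.add_apply] using h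
    rw [coeff_multiAffinePart, coeff_multiAffinePart]
    by_cases h1 : ∀ i, x.1 i ≤ 1
    · by_cases h2 : ∀ i, x.2 i ≤ 1
      · rw [if_pos h1, if_pos h2]
        push Not at hγ
        obtain ⟨i, hi⟩ := hγ
        have hx1 : x.1 i = 1 := by have := h1 i; have := h2 i; have := h12 i; omega
        have hx2 : x.2 i = 1 := by have := h1 i; have := h2 i; have := h12 i; omega
        by_cases hp : coeff x.1 P = 0
        · rw [hp, zero_mul]
        by_cases hq : coeff x.2 Q = 0
        · rw [hq, mul_zero]
        exfalso
        have hiP : i ∈ P.vars := (mem_vars_iff_mem_support i).2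
          ⟨x.1, mem_support_iff.2 hp, Finsupp.mem_support_iff.2 (by omega)⟩
        have hiQ : i ∈ Q.vars := (mem_vars_iff_mem_support i).2
          ⟨x.2, mem_support_iff.2 hq, Finsupp.mem_support_iff.2 (by omega)⟩
        exact Finset.disjoint_left.1 h hiP hiQ
      · rw [if_neg h2, mul_zero]
    · rw [if_neg h1, zero_mul]

/-- `MAP(1) = 1`. [cite: BorceaBranden2009II, §8.4] -/
theorem multiAffinePart_one [Fintype σ] [DecidableEq σ] : multiAffinePart (1 : MvPolynomial σ ℂ) = 1 :=
  multiAffinePart_of_isMultiAffine (by simpa using isMultiAffine_prod_X (σ := σ) (R := ℂ) ∅)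

/-- **`MAP` of a product of polynomials living in pairwise disjoint blocks of variables** is the product
of their `MAP`s. [cite: BorceaBranden2009II, §8.4 (definition of `MAP`)] -/
theorem multiAffinePart_prod_of_vars_subset [Fintype σ] [DecidableEq σ] {ι : Type*} [DecidableEq ι]
    (S : Finset ι) (P : ι → MvPolynomial σ ℂ) (B : ι → Finset σ) (hB : ∀ i ∈ S, (P i).vars ⊆ B i)
    (hdisj : ∀ i ∈ S, ∀ j ∈ S, i ≠ j → Disjoint (B i) (B j)) :
    multiAffinePart (∏ i ∈ S, P i) = ∏ i ∈ S, multiAffinePart (P i) := by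
  induction S using Finset.induction_on with
  | empty => simp [multiAffinePart_one]
  | insert a S ha ih =>
    rw [prod_insert ha, prod_insert ha, multiAffinePart_mul_of_disjoint_vars,
      ih (fun i hi => hB i (mem_insert_of_mem hi))
        (fun i hi j hj => hdisj i (mem_insert_of_mem hi) j (mem_insert_of_mem hj))]
    refine Finset.disjoint_of_subset_left (hB a (mem_insert_self a S)) ?_
    refine Finset.disjoint_of_subset_right
      ((vars_prod _).trans (Finset.biUnion_mono fun i hi => hB i (mem_insert_of_mem hi))) ?_
    rw [Finset.disjoint_biUnion_right]
    intro j hj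
    exact hdisj a (mem_insert_self _ _) j (mem_insert_of_mem hj) fun h => ha (h ▸ hj)

/-! ### Square-free monomials and elementary symmetric polynomials of a set of variables -/

/-- `MAP(z^S z^T) = z^{S ∪ T}` if `S, T` are disjoint, and `0` otherwise.
[cite: BorceaBranden2009II, §8.4 (definition of `MAP`)] -/
theorem multiAffinePart_prod_X_mul_prod_X [Fintype σ] [DecidableEq σ] (S T : Finset σ) :
    multiAffinePart ((∏ w ∈ S, X w : MvPolynomial σ ℂ) * ∏ w ∈ T, X w) =
      if Disjoint S T then ∏ w ∈ S ∪ T, X w else 0 := by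
  split_ifs with h
  · rw [← prod_union h]
    exact multiAffinePart_of_isMultiAffine (isMultiAffine_prod_X _)
  · rw [prod_X_eq_monomial, prod_X_eq_monomial, monomial_mul, one_mul, multiAffinePart_monomial, if_neg]
    intro hall
    obtain ⟨i, hiS, hiT⟩ := Finset.not_disjoint_iff.1 h
    have := hall i
    rw [Finsupp.add_apply, sum_single_one_apply, sum_single_one_apply, if_pos hiS, if_pos hiT] at this
    omega

/-- **The `k`-th elementary symmetric polynomial of the variables in `A`**,
`e_k(A) = Σ_{S ⊆ A, |S| = k} z^S` (the tree's `fiberEsymm b i k` is `setEsymm (fiber b i) k`).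
[cite: Amini2019, §3 (proof of Thm. 3.7: "symmetric and multiaffine polynomials in the two sets of
variables")] -/
def setEsymm (A : Finset σ) (k : ℕ) : MvPolynomial σ ℂ :=
  ∑ S ∈ powersetCard k A, ∏ w ∈ S, X w

/-- `e_0(A) = 1`. [folklore] -/
private theorem setEsymm_zero (A : Finset σ) : setEsymm A 0 = 1 := by
  rw [setEsymm, powersetCard_zero, sum_singleton, prod_empty]

/-- The variables of `e_k(A)` lie in `A`. [folklore] -/
private theorem vars_setEsymm_subset [DecidableEq σ] (A : Finset σ) (k : ℕ) : (setEsymm A k).vars ⊆ A := by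
  rw [setEsymm]
  refine (vars_sum_subset _ _).trans (Finset.biUnion_subset.2 fun S hS => ?_)
  refine (vars_prod _).trans (Finset.biUnion_subset.2 fun w hw => ?_)
  rw [vars_X]
  exact Finset.singleton_subset_iff.2 ((mem_powersetCard.1 hS).1 hw)

/-- **`MAP(e_a(A) e_b(A)) = binom(a+b, a) e_{a+b}(A)`**: a square-free monomial `z^U`, `|U| = a + b`,
arises from the `binom(a+b,a)` ordered splittings `U = S ⊔ T`, `|S| = a`. [cite: HallPuderSawin2018,
§2.2 (2.4) (the multi-matching weights `W_d`)] -/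
theorem multiAffinePart_setEsymm_mul_setEsymm [Fintype σ] [DecidableEq σ] (A : Finset σ) (a b : ℕ) :
    multiAffinePart (setEsymm A a * setEsymm A b) = ((a + b).choose a : ℂ) • setEsymm A (a + b) := by
  unfold setEsymm
  rw [sum_mul_sum, map_sum]
  simp_rw [map_sum, multiAffinePart_prod_X_mul_prod_X, ← sum_filter]
  rw [smul_sum]
  -- `binom(a+b,a) z^U = Σ_{S ⊆ U, |S| = a} z^U`
  have hU : ∀ U ∈ powersetCard (a + b) A,
      ((a + b).choose a : ℂ) • (∏ w ∈ U, X w : MvPolynomial σ ℂ) =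
        ∑ S ∈ powersetCard a U, ∏ w ∈ U, X w := by
    intro U hU
    rw [sum_const, card_powersetCard, (mem_powersetCard.1 hU).2, Nat.cast_smul_eq_nsmul]
  rw [sum_congr rfl hU]
  trans ∑ S ∈ powersetCard a A,
    ∑ U ∈ (powersetCard (a + b) A).filter (fun U => S ⊆ U), (∏ w ∈ U, X w : MvPolynomial σ ℂ)
  · refine sum_congr rfl fun S hS => ?_
    obtain ⟨hSA, hScard⟩ := mem_powersetCard.1 hS
    refine sum_nbij' (fun T => S ∪ T) (fun U => U \ S) ?_ ?_ ?_ ?_ ?_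
    · intro T hT
      obtain ⟨hT, hdisj⟩ := mem_filter.1 hT
      obtain ⟨hTA, hTcard⟩ := mem_powersetCard.1 hT
      refine mem_filter.2 ⟨mem_powersetCard.2 ⟨union_subset hSA hTA, ?_⟩, subset_union_left⟩
      rw [card_union_of_disjoint hdisj, hScard, hTcard]
    · intro U hU
      obtain ⟨hU, hSU⟩ := mem_filter.1 hU
      obtain ⟨hUA, hUcard⟩ := mem_powersetCard.1 hU
      refine mem_filter.2 ⟨mem_powersetCard.2 ⟨sdiff_subset.trans hUA, ?_⟩, disjoint_sdiff⟩
      rw [card_sdiff_of_subset hSU, hUcard, hScard]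
      omega
    · intro T hT
      exact union_sdiff_cancel_left (mem_filter.1 hT).2
    · intro U hU
      exact union_sdiff_of_subset (mem_filter.1 hU).2
    · intro T _
      rfl
  · rw [sum_comm' (t' := powersetCard (a + b) A) (s' := fun U => powersetCard a U)]
    intro S U
    constructor
    · rintro ⟨hS, hU⟩
      obtain ⟨hU, hSU⟩ := mem_filter.1 hU
      exact ⟨mem_powersetCard.2 ⟨hSU, (mem_powersetCard.1 hS).2⟩, hU⟩
    · rintro ⟨hS, hU⟩
      obtain ⟨hSU, hScard⟩ := mem_powersetCard.1 hS
      obtain ⟨hUA, _⟩ := mem_powersetCard.1 hU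
      exact ⟨mem_powersetCard.2 ⟨hSU.trans hUA, hScard⟩, mem_filter.2 ⟨hU, hSU⟩⟩

/-- **`MAP` of a product of elementary symmetric polynomials of one block**:
`MAP(∏_ℓ e_{m_ℓ}(A)) = multinomial(m) · e_{Σ m}(A)` — the number of ordered partitions of a
`(Σ m)`-set into blocks of sizes `m_ℓ`. [cite: HallPuderSawin2018, §2.2 (2.4)
(`W_d(n) = ∏_v multinomial(d; (n_e)_{e ∋ v}) / ∏_e binom(d, n_e)`)] -/
theorem multiAffinePart_prod_setEsymm [Fintype σ] [DecidableEq σ] {ι : Type*} [DecidableEq ι]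
    (A : Finset σ) (L : Finset ι) (m : ι → ℕ) :
    multiAffinePart (∏ ℓ ∈ L, setEsymm A (m ℓ)) =
      (Nat.multinomial L m : ℂ) • setEsymm A (∑ ℓ ∈ L, m ℓ) := by
  induction L using Finset.induction_on with
  | empty => simp [setEsymm_zero, multiAffinePart_one]
  | insert a L ha ih =>
    rw [prod_insert ha, ← multiAffinePart_mul_multiAffinePart, ih, mul_smul_comm, map_smul,
      multiAffinePart_setEsymm_mul_setEsymm, sum_insert ha, Nat.multinomial_insert ha, Nat.cast_mul,
      smul_smul, mul_comm]

/-- **Evaluating `e_k(A)` at a point supported on `A' ⊆ A` and constant (`= t`) there**: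
`binom(|A'|, k) t^k`. [folklore] -/
private theorem eval_setEsymm_of_subset {A A' : Finset σ} (hA' : A' ⊆ A) (φ : σ → ℂ) (t : ℂ)
    (h1 : ∀ w ∈ A', φ w = t) (h0 : ∀ w ∈ A, w ∉ A' → φ w = 0) (k : ℕ) :
    eval φ (setEsymm A k) = (A'.card.choose k : ℂ) * t ^ k := by
  classical
  unfold setEsymm
  rw [map_sum]
  have hterm : ∀ S ∈ powersetCard k A,
      eval φ (∏ w ∈ S, X w : MvPolynomial σ ℂ) = if S ⊆ A' then t ^ k else 0 := by
    intro S hS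
    rw [map_prod]
    simp only [eval_X]
    obtain ⟨hSA, hcard⟩ := mem_powersetCard.1 hS
    split_ifs with hsub
    · rw [← hcard, ← prod_const]
      exact prod_congr rfl fun w hw => h1 w (hsub hw)
    · obtain ⟨w, hwS, hwA'⟩ := not_subset.1 hsub
      exact prod_eq_zero hwS (h0 w (hSA hwS) hwA')
  rw [sum_congr rfl hterm, ← sum_filter, sum_const, nsmul_eq_mul]
  congr 2
  rw [← card_powersetCard k A']
  congr 1
  ext S
  simp only [mem_filter, mem_powersetCard]
  constructor
  · rintro ⟨⟨-, hc⟩, hs⟩; exact ⟨hs, hc⟩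
  · rintro ⟨hs, hc⟩; exact ⟨⟨hs.trans hA', hc⟩, hs⟩

end MapAlgebra

/-! ## §3 The covering polynomial of a loopless multigraph and its weak Hurwitz stability -/

section Cover

variable {V β : Type*} [Fintype V] [DecidableEq V] [Fintype β]

/-- The fibre of `(v, k) ↦ v` over `v` — the block of the `N` covering variables `x_{v,1}, …, x_{v,N}`
above the vertex `v` — has `N` elements. [cite: Amini2019, §2.1 ("`V(H) ≔ {v_i : v ∈ V(G), 1 ≤ i ≤ d}`")] -/
theorem card_fiber_fst (N : ℕ) (v : V) : (fiber (Prod.fst : V × Fin N → V) v).card = N := by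
  have h : fiber (Prod.fst : V × Fin N → V) v = ({v} : Finset V) ×ˢ (univ : Finset (Fin N)) := by
    ext ⟨v', k⟩
    simp [mem_fiber, eq_comm]
  rw [h, card_product, card_singleton, one_mul, card_univ, Fintype.card_fin]

/-- The first `m ≤ N` points of the fibre over `v` are `m` in number. [folklore] -/
private theorem card_fiber_fst_filter_lt (N : ℕ) (v : V) {m : ℕ} (hm : m ≤ N) :
    ((fiber (Prod.fst : V × Fin N → V) v).filter fun w => (w.2 : ℕ) < m).card = m := by
  classical
  have h : ((fiber (Prod.fst : V × Fin N → V) v).filter fun w => (w.2 : ℕ) < m) =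
      ((univ : Finset (Fin N)).filter fun k : Fin N => (k : ℕ) < m).map
        ⟨Prod.mk v, Prod.mk_right_injective v⟩ := by
    ext ⟨v', k⟩
    simp only [mem_filter, mem_fiber, mem_map, mem_univ, true_and, Function.Embedding.coeFn_mk,
      Prod.mk.injEq]
    constructor
    · rintro ⟨rfl, hk⟩; exact ⟨k, hk, rfl, rfl⟩
    · rintro ⟨k', hk', rfl, rfl⟩; exact ⟨rfl, hk'⟩
  rw [h, card_map, Fin.card_filter_val_lt, min_eq_right hm]

/-- At a block-constant point `ζ ∘ pr₁`, `e_j(block v) = binom(N, j) ζ_v^j`.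
[cite: BorceaBranden2009, §2.2 ("(b) `Π↓_κ ∘ Π↑_κ = id`")] -/
theorem eval_comp_fst_fiberEsymm (N : ℕ) (ζ : V → ℂ) (v : V) (j : ℕ) :
    eval (ζ ∘ Prod.fst) (fiberEsymm (Prod.fst : V × Fin N → V) v j : MvPolynomial (V × Fin N) ℂ) =
      (N.choose j : ℂ) * ζ v ^ j := by
  rw [← eval_rename, rename_fiberEsymm, card_fiber_fst, map_nsmul, map_pow, eval_X, nsmul_eq_mul]

/-- **The weights of the covering bond polynomial**, `w_N(j) = j! (N-j)! N^{2j}`: summing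
`∏_{k=1}^N (1 + N² x_{u,k} x_{v,σ(k)})` over `σ ∈ S_N` gives `Σ_j w_N(j) e_j(x_u) e_j(x_v)` (Amini's `f_e`,
with the right-half-plane sign and the edge weight `N²`). [cite: Amini2019, §3 proof of Thm. 3.7
(the polynomials `f_e`)] -/
def coverWeight (N j : ℕ) : ℂ :=
  ((Nat.factorial j * Nat.factorial (N - j) : ℕ) : ℂ) * (N : ℂ) ^ (2 * j)

/-- **The covering bond polynomial** of the bond `b` (end points `s b`, `t b`) in the `N|V|` covering
variables `x_{v,k}`: `f_b = Σ_{j=0}^{N} j!(N-j)! N^{2j} e_j(x_{s b,·}) e_j(x_{t b,·})` — Amini's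
`f_e = Σ_{σ_e ∈ S_d} ∏_k (1 - x_{h(e)k} x_{t(e)σ_e(k)})`, here with `+ N² x x'` (weak Hurwitz version).
[cite: Amini2019, §3 proof of Thm. 3.7 (the polynomials `f_e`)] -/
def coverBond (s t : β → V) (N : ℕ) (b : β) : MvPolynomial (V × Fin N) ℂ :=
  ∑ j ∈ range (N + 1), C (coverWeight N j) *
    (fiberEsymm (Prod.fst : V × Fin N → V) (s b) j * fiberEsymm (Prod.fst : V × Fin N → V) (t b) j)

/-- **The covering polynomial of the multigraph** `(V, β, s, t)`: `F = ∏_b f_b`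
(`= |S_d|^{|E|} · 𝔼_{σ} P_{σ,G}` in Amini's notation, the average over all `N`-sheeted coverings of the
edge products). [cite: Amini2019, §3 proof of Thm. 3.7 ("`𝔼_σ P_{σ,G}(x) = |𝒞_{d,G}|⁻¹ ∏_e f_e(x)`")] -/
def coverPoly (s t : β → V) (N : ℕ) : MvPolynomial (V × Fin N) ℂ :=
  ∏ b, coverBond s t N b

omit [Fintype β] in
/-- **The diagonal of the covering bond polynomial**: at a block-constant point,
`f_b(ζ ∘ pr₁) = N! (1 + N² ζ_{s b} ζ_{t b})^N` (Amini: "`Σ_{σ_e ∈ S_d} ∏_{k=1}^d (1 - xy) = d!(1 - xy)^d`").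
[cite: Amini2019, §3 proof of Thm. 3.7] -/
theorem eval_comp_fst_coverBond (s t : β → V) (N : ℕ) (b : β) (ζ : V → ℂ) :
    eval (ζ ∘ Prod.fst) (coverBond s t N b) =
      (Nat.factorial N : ℂ) * (1 + (N : ℂ) ^ 2 * (ζ (s b) * ζ (t b))) ^ N := by
  unfold coverBond
  rw [map_sum, add_comm (1 : ℂ), add_pow, mul_sum]
  simp only [map_mul, eval_C, eval_comp_fst_fiberEsymm, one_pow, mul_one]
  refine sum_congr rfl fun j hj => ?_
  have hjN : j ≤ N := Nat.lt_succ_iff.1 (mem_range.1 hj)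
  have hfac : ((Nat.factorial j * Nat.factorial (N - j) : ℕ) : ℂ) * (N.choose j : ℂ) =
      (Nat.factorial N : ℂ) := by
    rw [← Nat.cast_mul, ← Nat.choose_mul_factorial_mul_factorial hjN]
    congr 1
    ring
  rw [coverWeight, pow_mul]
  linear_combination ((N.choose j : ℂ) * ((N : ℂ) ^ 2) ^ j * (ζ (s b) * ζ (t b)) ^ j) * hfac

omit [Fintype β] in
/-- The covering bond polynomial of a bond with distinct end points is multi-affine (its two blocks of
variables are disjoint). [cite: Amini2019, §3 proof of Thm. 3.7 ("symmetric and multiaffine")] -/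
theorem isMultiAffine_coverBond (s t : β → V) (N : ℕ) {b : β} (hb : s b ≠ t b) :
    IsMultiAffine (coverBond s t N b) := by
  unfold coverBond
  refine IsMultiAffine.sum _ fun j _ => ?_
  rw [← smul_eq_C_mul]
  refine IsMultiAffine.smul ?_ _
  intro w
  refine (degreeOf_mul_le _ _ _).trans ?_
  have h1 := degreeOf_fiberEsymm_le (Prod.fst : V × Fin N → V) (s b) j w
  have h2 := degreeOf_fiberEsymm_le (Prod.fst : V × Fin N → V) (t b) j w
  by_cases hs : w.1 = s b
  · have ht : ¬ w.1 = t b := fun h => hb (hs ▸ h)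
    rw [if_pos hs] at h1
    rw [if_neg ht] at h2
    omega
  · rw [if_neg hs] at h1
    split_ifs at h2 <;> omega

omit [Fintype β] in
/-- The covering bond polynomial is symmetric within every block of covering variables.
[cite: Amini2019, §3 proof of Thm. 3.7 ("symmetric … in the two sets of variables")] -/
theorem isFiberSymmetric_coverBond (s t : β → V) (N : ℕ) (b : β) :
    IsFiberSymmetric (Prod.fst : V × Fin N → V) (coverBond s t N b) := by
  intro e he
  unfold coverBond
  rw [map_sum]
  refine sum_congr rfl fun j _ => ?_
  rw [map_mul, map_mul, rename_C, rename_perm_fiberEsymm _ e he, rename_perm_fiberEsymm _ e he]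

omit [Fintype β] in
/-- **Amini's Theorem 3.7, bond step: `f_b` is weakly Hurwitz stable** (for a bond with distinct end
points).  By the Grace–Walsh–Szegő theorem in blocks (the tree's
`exists_eval_eq_eval_comp_of_hasCoincidenceProperty` for the right half-plane) the value of `f_b` at a
point of `H_{π/2}^{N|V|}` is a value `N!(1 + N² ζ ζ')^N` with `Re ζ, Re ζ' > 0`, which is `≠ 0` since
`ζζ' ∉ (-∞, 0]`. [cite: Amini2019, Thm. 3.7 (proof: "by Theorem 2.3 [Grace–Walsh–Szegő] `f_e` is stable
if and only if `d!(1-xy)^d` is stable")] -/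
theorem coverBond_weaklyHurwitzStable (s t : β → V) (N : ℕ) {b : β} (hb : s b ≠ t b) :
    IsHThetaStable (Real.pi / 2) (coverBond s t N b) := by
  classical
  rw [isHThetaStable_pi_div_two_iff]
  intro W hW
  obtain ⟨ζ, hζ, hev⟩ := exists_eval_eq_eval_comp_of_hasCoincidenceProperty
    (Prod.fst : V × Fin N → V) (fun _ => {z : ℂ | 0 < (Complex.I * z + 0).im})
    (fun _ => hasCoincidenceProperty_im_affine_pos Complex.I_ne_zero 0) (fun _ => ⟨1, by simp⟩)
    (isMultiAffine_coverBond s t N hb) (isFiberSymmetric_coverBond s t N b) W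
    (fun w => by simpa using hW w)
  rw [hev, eval_comp_fst_coverBond]
  have hζ' : ∀ i, 0 < (ζ i).re := fun i => by simpa using hζ i
  refine mul_ne_zero (by exact_mod_cast (Nat.factorial_pos N).ne') (pow_ne_zero _ ?_)
  have h := one_add_natCast_mul_ne_zero_of_re_pos (N ^ 2) (hζ' (s b)) (hζ' (t b))
  push_cast at h
  exact h

/-- **The covering polynomial of a loopless multigraph is weakly Hurwitz stable** (product of the
stable `f_b`). [cite: Amini2019, Thm. 3.7 (proof: "`𝔼_σ P_{σ,G}` is stable being a product of stable
polynomials")] -/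
theorem coverPoly_weaklyHurwitzStable (s t : β → V) (N : ℕ) (hst : ∀ b, s b ≠ t b) :
    IsHThetaStable (Real.pi / 2) (coverPoly s t N) := by
  rw [isHThetaStable_pi_div_two_iff]
  intro W hW
  unfold coverPoly
  rw [map_prod]
  exact prod_ne_zero_iff.2 fun b _ =>
    (isHThetaStable_pi_div_two_iff _).1 (coverBond_weaklyHurwitzStable s t N (hst b)) W hW

/-- `F(0) = (N!)^{|β|}`. [cite: Amini2019, §3 proof of Thm. 3.7] -/
theorem eval_zero_coverPoly (s t : β → V) (N : ℕ) :
    eval (0 : V × Fin N → ℂ) (coverPoly s t N) = (Nat.factorial N : ℂ) ^ Fintype.card β := by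
  unfold coverPoly
  rw [map_prod]
  have h : ∀ b, eval (0 : V × Fin N → ℂ) (coverBond s t N b) = Nat.factorial N := fun b => by
    have h := eval_comp_fst_coverBond s t N b 0
    rw [show ((0 : V → ℂ) ∘ Prod.fst : V × Fin N → ℂ) = 0 from rfl] at h
    rw [h]
    simp
  simp_rw [h, prod_const, card_univ]

omit [DecidableEq V] [Fintype β] in
/-- `MAP` does not change the value at `0` (the constant coefficient). [cite: BorceaBranden2009II, §8.4] -/
theorem eval_zero_multiAffinePart {σ : Type*} [Fintype σ] [DecidableEq σ] (F : MvPolynomial σ ℂ) :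
    eval (0 : σ → ℂ) (multiAffinePart F) = eval (0 : σ → ℂ) F := by
  rw [MvPolynomial.eval_zero]
  show coeff 0 (multiAffinePart F) = coeff 0 F
  rw [coeff_multiAffinePart, if_pos]
  intro i
  simp

/-- **`MAP(F)` is weakly Hurwitz stable** (Borcea–Brändén II §8.4: `MAP` preserves weak Hurwitz
stability; `MAP(F) ≠ 0` since `MAP(F)(0) = F(0) = (N!)^{|β|}`). [cite: Amini2019, Thm. 3.7 (proof:
"`MAP[𝔼_σ P_{σ,G}] = μ_{d,G}` … Hence `μ_{d,G}(x)` is stable")] [cite: BorceaBranden2009II, §8.4] -/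
theorem multiAffinePart_coverPoly_weaklyHurwitzStable (s t : β → V) (N : ℕ) (hst : ∀ b, s b ≠ t b) :
    IsHThetaStable (Real.pi / 2) (multiAffinePart (coverPoly s t N)) := by
  rcases multiAffinePart_weaklyHurwitzStable (coverPoly_weaklyHurwitzStable s t N hst) with h | h
  · exact h
  · exfalso
    have h0 := eval_zero_multiAffinePart (coverPoly s t N)
    rw [h, map_zero, eval_zero_coverPoly] at h0
    exact pow_ne_zero _ (by exact_mod_cast (Nat.factorial_pos N).ne') h0.symm

/-! ## §4 The multi-matching polynomial with capacities as a face value of `MAP(F)` -/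

/-- **The face point `φ_{c,τ}`**: `τ_v` on the first `c_v` covering variables above `v`, `0` on the others
(for `c_v = N` the diagonalisation `x_{v,k} := τ_v` of Amini's Cor. 3.8; lower capacities switch off
covering variables). [cite: Amini2019, Cor. 3.8 ("putting `x = (x,…,x)`")] -/
def facePoint (N : ℕ) (c : V → ℕ) (τ : V → ℂ) : V × Fin N → ℂ :=
  fun w => if (w.2 : ℕ) < c w.1 then τ w.1 else 0

/-- **Non-vanishing on the faces.** For a loopless multigraph, every capacity `c` and every `τ` with
`Re τ_v > 0`, `MAP(F)(φ_{c,τ}) ≠ 0`. [cite: Amini2019, Thm. 3.7 and Cor. 3.8] [cite: Wagner2011,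
Lemma 2.4 (d)] -/
theorem eval_facePoint_multiAffinePart_coverPoly_ne_zero (s t : β → V) (N : ℕ) (hst : ∀ b, s b ≠ t b)
    (c : V → ℕ) {τ : V → ℂ} (hτ : ∀ v, 0 < (τ v).re) :
    eval (facePoint N c τ) (multiAffinePart (coverPoly s t N)) ≠ 0 := by
  classical
  refine IsHThetaStable.eval_ne_zero_of_face (multiAffinePart_coverPoly_weaklyHurwitzStable s t N hst)
    ?_ (univ.filter fun w : V × Fin N => ¬ (w.2 : ℕ) < c w.1) _ (fun w hw => ?_) (fun w hw => ?_)
  · rw [eval_zero_multiAffinePart, eval_zero_coverPoly]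
    exact pow_ne_zero _ (by exact_mod_cast (Nat.factorial_pos N).ne')
  · simp only [mem_filter, mem_univ, true_and] at hw
    simp [facePoint, hw]
  · simp only [mem_filter, mem_univ, true_and, not_not] at hw
    simp only [facePoint, hw, if_true]
    exact hτ w.1

/-- **The bond ends at the vertex `v`**: the bonds starting at `v` and the bonds ending at `v`
(a loop at `v` would be counted twice). [cite: HallPuderSawin2018, §2.2 (2.4) ("`(n_e)_{e ∋ v}`")] -/
def bondEnds (s t : β → V) (v : V) : Finset (β ⊕ β) :=
  (univ.filter fun b => s b = v).disjSum (univ.filter fun b => t b = v)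

/-- **The degree at `v` of the multi-matching `n`**: `d_v(n) = Σ_{e ∋ v} n_e`.
[cite: HallPuderSawin2018, §2.2 (2.4)] -/
def bondDegree (s t : β → V) (n : β → ℕ) (v : V) : ℕ :=
  ∑ ℓ ∈ bondEnds s t v, Sum.elim n n ℓ

omit [Fintype V] in
/-- `d_v(n) = Σ_{b : s b = v} n_b + Σ_{b : t b = v} n_b`. [cite: HallPuderSawin2018, §2.2 (2.4)] -/
theorem bondDegree_eq (s t : β → V) (n : β → ℕ) (v : V) :
    bondDegree s t n v = (∑ b ∈ univ.filter (fun b => s b = v), n b) + ∑ b ∈ univ.filter (fun b => t b = v), n b := by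
  rw [bondDegree, bondEnds, sum_disjSum]
  rfl

/-- **Regrouping a product over bond ends by vertices** (`∏_e a(h(e)) a(t(e)) = ∏_v ∏_{e ∋ v} a(v)`, the
regrouping behind the vertex weights `∏_v multinomial(d; (n_e)_{e ∋ v})` of (2.4)).
[cite: HallPuderSawin2018, §2.2 (2.4)] -/
theorem prod_bondEnds_eq_prod_fiber {M : Type*} [CommMonoid M] (s t : β → V) (h : V → ℕ → M) (n : β → ℕ) :
    (∏ b, h (s b) (n b)) * ∏ b, h (t b) (n b) = ∏ v, ∏ ℓ ∈ bondEnds s t v, h v (Sum.elim n n ℓ) := by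
  simp only [bondEnds, prod_disjSum, Sum.elim_inl, Sum.elim_inr]
  rw [prod_mul_distrib, ← prod_fiberwise univ s (fun b => h (s b) (n b)),
    ← prod_fiberwise univ t (fun b => h (t b) (n b))]
  congr 1
  · refine prod_congr rfl fun v _ => prod_congr rfl fun b hb => ?_
    rw [(mem_filter.1 hb).2]
  · refine prod_congr rfl fun v _ => prod_congr rfl fun b hb => ?_
    rw [(mem_filter.1 hb).2]

/-- **One block: `MAP(∏_ℓ e_{m_ℓ}(block v))` at the face point** is
`multinomial(m) · binom(c_v, Σ m) τ_v^{Σ m}`. [cite: HallPuderSawin2018, §2.2 (2.4)] -/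
theorem eval_facePoint_multiAffinePart_prod_setEsymm (N : ℕ) (c : V → ℕ) (hc : ∀ v, c v ≤ N)
    (τ : V → ℂ) (v : V) {ι : Type*} [DecidableEq ι] (L : Finset ι) (m : ι → ℕ) :
    eval (facePoint N c τ)
        (multiAffinePart (∏ ℓ ∈ L, setEsymm (fiber (Prod.fst : V × Fin N → V) v) (m ℓ))) =
      (Nat.multinomial L m : ℂ) * (((c v).choose (∑ ℓ ∈ L, m ℓ) : ℂ) * τ v ^ (∑ ℓ ∈ L, m ℓ)) := by
  classical
  rw [multiAffinePart_prod_setEsymm, smul_eval,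
    eval_setEsymm_of_subset (A' := (fiber (Prod.fst : V × Fin N → V) v).filter fun w => (w.2 : ℕ) < c v)
      (filter_subset _ _) _ (τ v) ?_ ?_, card_fiber_fst_filter_lt N v (hc v)]
  · intro w hw
    obtain ⟨hw1, hw2⟩ := mem_filter.1 hw
    rw [mem_fiber] at hw1
    simp only [facePoint, hw1, hw2, if_true]
  · intro w hw hw'
    rw [mem_fiber] at hw
    have h : ¬ (w.2 : ℕ) < c v := fun h' => hw' (mem_filter.2 ⟨(mem_fiber _).2 hw, h'⟩)
    simp only [facePoint, hw, h, if_false]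

/-- **The face value of `MAP(F)` is the multi-matching polynomial with capacities**:
`MAP(F)(φ_{c,τ}) = Σ_n ∏_b w_N(n_b) ∏_v multinomial((n_e)_{e ∋ v}) binom(c_v, d_v(n)) τ_v^{d_v(n)}`,
the sum over `n : β → {0,…,N}` — Hall–Puder–Sawin's formula (2.4)
`M_{d,G} = Σ_n W_d(n) …`, `W_d(n) = ∏_v multinomial(d; (n_e)_{e∋v}) / ∏_e binom(d,n_e)`, here with
vertex capacities `c_v ≤ N` and edge weight `N²`. [cite: HallPuderSawin2018, §2.2 (2.4)]
[cite: Amini2019, Cor. 3.8] -/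
theorem eval_facePoint_multiAffinePart_coverPoly [DecidableEq β] (s t : β → V) (N : ℕ) (c : V → ℕ)
    (hc : ∀ v, c v ≤ N) (τ : V → ℂ) :
    eval (facePoint N c τ) (multiAffinePart (coverPoly s t N)) =
      ∑ n ∈ Fintype.piFinset (fun _ : β => range (N + 1)),
        (∏ b, coverWeight N (n b)) *
          ∏ v, ((Nat.multinomial (bondEnds s t v) (Sum.elim n n) : ℂ) *
            (((c v).choose (bondDegree s t n v) : ℂ) * τ v ^ bondDegree s t n v)) := by
  classical
  -- expand the product over bonds
  have hexp : coverPoly s t N = ∑ n ∈ Fintype.piFinset (fun _ : β => range (N + 1)),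
      C (∏ b, coverWeight N (n b)) *
        ∏ b, (fiberEsymm (Prod.fst : V × Fin N → V) (s b) (n b) *
          fiberEsymm (Prod.fst : V × Fin N → V) (t b) (n b) : MvPolynomial (V × Fin N) ℂ) := by
    unfold coverPoly coverBond
    rw [prod_univ_sum]
    refine sum_congr rfl fun n _ => ?_
    rw [prod_mul_distrib, map_prod]
  -- regroup the bond ends by vertices
  have hregroup : ∀ n : β → ℕ,
      (∏ b, (fiberEsymm (Prod.fst : V × Fin N → V) (s b) (n b) *
        fiberEsymm (Prod.fst : V × Fin N → V) (t b) (n b) : MvPolynomial (V × Fin N) ℂ)) =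
      ∏ v, ∏ ℓ ∈ bondEnds s t v, setEsymm (fiber (Prod.fst : V × Fin N → V) v) (Sum.elim n n ℓ) := by
    intro n
    rw [prod_mul_distrib]
    exact prod_bondEnds_eq_prod_fiber s t
      (fun v j => (setEsymm (fiber (Prod.fst : V × Fin N → V) v) j : MvPolynomial (V × Fin N) ℂ)) n
  rw [hexp, map_sum, map_sum]
  refine sum_congr rfl fun n _ => ?_
  rw [← smul_eq_C_mul, map_smul, smul_eval, hregroup n,
    multiAffinePart_prod_of_vars_subset univ _ (fun v => fiber (Prod.fst : V × Fin N → V) v) ?_ ?_,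
    map_prod]
  · congr 1
    refine prod_congr rfl fun v _ => ?_
    rw [eval_facePoint_multiAffinePart_prod_setEsymm N c hc τ v]
    rfl
  · intro v _
    exact (vars_prod _).trans (Finset.biUnion_subset.2 fun ℓ _ => vars_setEsymm_subset _ _)
  · intro v _ v' _ hvv'
    exact Finset.disjoint_left.2 fun w hw hw' => hvv' (((mem_fiber _).1 hw).symm.trans ((mem_fiber _).1 hw'))

/-- **Amini's Theorem 3.7 ∕ Corollary 3.8 with capacities (weak Hurwitz form): the multi-matching
polynomial of a loopless finite multigraph does not vanish when all `Re τ_v > 0`.**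
[cite: Amini2019, Thm. 3.7 and Cor. 3.8] [cite: HallPuderSawin2018, §2.2 (2.4)] -/
theorem multiMatchingSum_ne_zero [DecidableEq β] (s t : β → V) (N : ℕ) (hst : ∀ b, s b ≠ t b) (c : V → ℕ)
    (hc : ∀ v, c v ≤ N) {τ : V → ℂ} (hτ : ∀ v, 0 < (τ v).re) :
    ∑ n ∈ Fintype.piFinset (fun _ : β => range (N + 1)),
        (∏ b, coverWeight N (n b)) *
          ∏ v, ((Nat.multinomial (bondEnds s t v) (Sum.elim n n) : ℂ) *
            (((c v).choose (bondDegree s t n v) : ℂ) * τ v ^ bondDegree s t n v)) ≠ 0 := by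
  rw [← eval_facePoint_multiAffinePart_coverPoly s t N c hc τ]
  exact eval_facePoint_multiAffinePart_coverPoly_ne_zero s t N hst c hτ

end Cover

end Literature.Combinatorics.StablePolynomials

end
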